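import Summits.QuantumFields.YangMills.Theorems.UnitScaleTiltSmoothLiftLoopBounds
import Summits.QuantumFields.YangMills.Theorems.UnitScaleTiltSmoothLiftInterpPlaq
import Summits.QuantumFields.YangMills.Theorems.UnitScaleTiltSmoothLiftFibre
import HarnessLib

/-!
# Route `UnitScaleTilt`, crux K1 child «MinimiserStabilityRegPr» (stmt-QuantumFields-19200), stub `stub_smoothLift` (G-K1a-2′) — helper P3d₂:
# CONSISTENCY OF THE SMOOTH INTERPOLATION — `‖V(c) − avg(interp V)(c)‖ = O(|F|² + |∇F|)`

Fleet seat `ym-ust-19200-p2` (gen 0).  For a coarse `SU(2)` field `V` with plaquettes `|V(∂p) − 1| ≤ a` and covariant-constancy defect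
`‖V(y,κ)F(y+e_κ)V(y,κ)* − F(y)‖ ≤ b′`, the block average (0.4) with the printed exp-mean-log operation of the interpolation
`W = interp V` (`UnitScaleTiltSmoothLiftInterpDefs`) is `V` up to second order:
**`norm_sub_avgFun_interp_le`** — `‖V(c) − W̄(c)‖ ≤ 2(3T² + d²b′)`, `T = (d+2)L·d·a` (`T ≤ 1/8`, `3T² + d²b′ ≤ 1/2`).
§1 per loop (`loop_estimates`): the loop variables are products of exponentials (`UnitScaleTiltSmoothLiftLoopSplit.coe_loopHol_interp`) with
total exponent norm `≤ T`, so `|loop − 1| ≤ 2T` (the guard of (0.4) is on) and `‖log loop − (MAIN + E)‖ ≤ 3T²`, `‖E‖ ≤ d²b′`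
(`UnitScaleTiltSmoothLiftLoopSum.sum_loopExps_eq`); §2 summing over the index set, `Σ MAIN = 0` (`sum_main_eq_zero`), so the correction
factor `exp(|I|⁻¹Σ log loop)` is within `2(3T² + d²b′)` of `1`, and `axialAvg (interp V) = V` (`UnitScaleTiltSmoothLiftLoopBounds`).
This is the located hypothesis of the exact-lift correctors (`BlockAvgCorrector.exists_corrector_T3`, `SmoothLiftCorrection`).
[cite: Balaban1987RG1, (0.4) p.253; King1986, (A.5) p.676]
-/

noncomputable section

open scoped Matrix.Norms.L2Operator BigOperators

namespace Summit.QuantumFields.YangMills.Theorems.SmoothLiftInterp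

open Literature.MathematicalPhysics.QuantumFieldTheory.Balaban1983to89
open MatrixLog T4Continuum AveragingRT BlockAveraging BlockAveragingSection BlockAveragingSectionPlaq NormedSpace ExpMeanLog
open BlockAveragingEMLHaarAC (coe_avg_expMeanLogSU)
open Summit.QuantumFields.YangMills.Theorems.SmoothLiftFibre (exp_sub_one_le_two_mul)

variable {P : Params} {j : ℕ}

/-! ## §1 One loop: small, and its logarithm is `MAIN + O(d²b′) + O(T²)` -/

section OneLoop

/-- Integer bounds `−h ≤ v ≤ h` in real absolute value. [folklore] -/
private theorem abs_cast_le {v : ℤ} {h : ℕ} (hv : -(h : ℤ) ≤ v ∧ v ≤ h) : |((v : ℤ) : ℝ)| ≤ (h : ℝ) := by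
  have h1 : ((v : ℤ) : ℝ) ≤ (((h : ℕ) : ℤ) : ℝ) := by exact_mod_cast hv.2
  have h2 : ((-((h : ℕ) : ℤ) : ℤ) : ℝ) ≤ ((v : ℤ) : ℝ) := by exact_mod_cast hv.1
  rw [Int.cast_natCast] at h1; rw [Int.cast_neg, Int.cast_natCast] at h2
  exact abs_le.mpr ⟨h2, h1⟩

/-- **ONE LOOP OF THE INTERPOLATION**: with `T = (d+2)L·d·a ≤ 1/8`, every loop variable of (0.4) of `interp V` at `c = ⟨y, y+e_μ⟩` satisfies
`|loop − 1| ≤ 2T` and `‖log loop − (S(σ,n) − S(σ′,n) + 2L·potAt F n μ + E)‖ ≤ 3T²` for some `‖E‖ ≤ d²b′`. [cite: Balaban1987RG1, (0.4) p.253] -/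
theorem loop_estimates (hj : j + 1 ≤ P.m + P.K) (V : GaugeField P (j+1) (Matrix.specialUnitaryGroup (Fin 2) ℂ)) {a b' : ℝ}
    (hV : ∀ (y : Site P (j+1)) (κ μ : Fin P.d),
      ‖((plaqElt V y κ μ : Matrix.specialUnitaryGroup (Fin 2) ℂ) : Matrix (Fin 2) (Fin 2) ℂ) - 1‖ ≤ a)
    (hcc : ∀ (y : Site P (j+1)) (κ ρ μ : Fin P.d),
      ‖((V ⟨y, κ⟩ : Matrix.specialUnitaryGroup (Fin 2) ℂ) : Matrix (Fin 2) (Fin 2) ℂ) * curv V (y.shift κ) ρ μ *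
          star ((V ⟨y, κ⟩ : Matrix.specialUnitaryGroup (Fin 2) ℂ) : Matrix (Fin 2) (Fin 2) ℂ) - curv V y ρ μ‖ ≤ b')
    (hT : ((P.d : ℝ) + 2) * (P.L : ℝ) * (P.d : ℝ) * a ≤ 1 / 8) (y : Site P (j+1)) (μ : Fin P.d) (r : Fin P.d → Fin P.L)
    (σ σ' : Equiv.Perm (Fin P.d)) :
    dist1 (loopHol (interp V) ⟨y, μ⟩ (r, σ, σ')) ≤ 2 * (((P.d : ℝ) + 2) * (P.L : ℝ) * (P.d : ℝ) * a) ∧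
      ∃ E : Matrix (Fin 2) (Fin 2) ℂ, ‖E‖ ≤ (P.d : ℝ) ^ 2 * b' ∧
        ‖mlog ((loopHol (interp V) ⟨y, μ⟩ (r, σ, σ') : Matrix.specialUnitaryGroup (Fin 2) ℂ) : Matrix (Fin 2) (Fin 2) ℂ) -
            ((stepExps P (curv V y) 0 (stairWord σ (off r))).sum - (stepExps P (curv V y) 0 (stairWord σ' (off r))).sum +
              (2 * (P.L : ℝ)) • potAt P (curv V y) (off r) μ + E)‖ ≤ 3 * (((P.d : ℝ) + 2) * (P.L : ℝ) * (P.d : ℝ) * a) ^ 2 := by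
  letI : NormedAlgebra ℚ (Matrix (Fin 2) (Fin 2) ℂ) := NormedAlgebra.restrictScalars ℚ ℂ _
  -- constants
  set T : ℝ := ((P.d : ℝ) + 2) * (P.L : ℝ) * (P.d : ℝ) * a with hTdef
  have hL : (0 : ℝ) < P.L := Nat.cast_pos.mpr P.L_pos
  have hL1 : (1 : ℝ) ≤ P.L := by exact_mod_cast P.L_pos
  have hd1 : (1 : ℝ) ≤ P.d := by exact_mod_cast P.hd
  have ha : 0 ≤ a := le_trans (norm_nonneg _) (hV y μ μ)
  have hT0 : 0 ≤ T := by positivity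
  set hh : ℕ := (P.L - 1) / 2 with hhh
  have hLn : P.L = 2 * hh + 1 := (two_mul_half_add_one P).symm
  have hLr : (P.L : ℝ) = 2 * hh + 1 := by exact_mod_cast hLn
  have hh0 : (0 : ℝ) ≤ hh := Nat.cast_nonneg _
  have hnb : ∀ ν, -(hh : ℤ) ≤ off r ν ∧ off r ν ≤ (hh : ℤ) := fun ν => off_bounds r ν
  set U : Matrix (Fin 2) (Fin 2) ℂ := ((V ⟨y, μ⟩ : Matrix.specialUnitaryGroup (Fin 2) ℂ) : Matrix (Fin 2) (Fin 2) ℂ) with hU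
  set F := curv V y with hF
  set F'' : Fin P.d → Fin P.d → Matrix (Fin 2) (Fin 2) ℂ := fun ρ ν => U * curv V (y.shift μ) ρ ν * star U with hF''
  have hFn : ∀ ρ ν, ‖F ρ ν‖ ≤ 2 * a := fun ρ ν => (norm_curv_le V y ρ ν).trans (by linarith [hV y ρ ν])
  have hF''n : ∀ ρ ν, ‖F'' ρ ν‖ ≤ 2 * a := fun ρ ν => by
    show ‖U * curv V (y.shift μ) ρ ν * star U‖ ≤ 2 * a
    rw [hU, norm_conj_eq]; exact (norm_curv_le V _ ρ ν).trans (by linarith [hV (y.shift μ) ρ ν])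
  -- the list
  have hprod := coe_loopHol_interp hj V y μ r σ σ'
  obtain ⟨E, hsum, hEn⟩ := sum_loopExps_eq V y μ r σ σ' (hcc y μ)
  set l := stepExps P (curv V y) 0 (stairWord σ (off r)) ++
        (stepExps P (curv V y) (off r) (List.replicate ((((P.L - 1) / 2 : ℕ) : ℤ) - off r μ).toNat (μ, true)) ++
        ([((P.L : ℝ) + 1) • potAt P (curv V y) (Function.update (off r) μ (((P.L - 1) / 2 : ℕ) : ℤ)) μ] ++
        (stepExps P (fun ρ ν => ((V ⟨y, μ⟩ : Matrix.specialUnitaryGroup (Fin 2) ℂ) : Matrix (Fin 2) (Fin 2) ℂ) * curv V (y.shift μ) ρ ν *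
            star ((V ⟨y, μ⟩ : Matrix.specialUnitaryGroup (Fin 2) ℂ) : Matrix (Fin 2) (Fin 2) ℂ))
            (Function.update (off r) μ (-(((P.L - 1) / 2 : ℕ) : ℤ))) (List.replicate (off r μ + (((P.L - 1) / 2 : ℕ) : ℤ)).toNat (μ, true)) ++
        (stepExps P (fun ρ ν => ((V ⟨y, μ⟩ : Matrix.specialUnitaryGroup (Fin 2) ℂ) : Matrix (Fin 2) (Fin 2) ℂ) * curv V (y.shift μ) ρ ν *
            star ((V ⟨y, μ⟩ : Matrix.specialUnitaryGroup (Fin 2) ℂ) : Matrix (Fin 2) (Fin 2) ℂ))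
            (off r) (wordRev (stairWord σ' (off r))) ++
        (stepExps P (fun ρ ν => ((V ⟨y, μ⟩ : Matrix.specialUnitaryGroup (Fin 2) ℂ) : Matrix (Fin 2) (Fin 2) ℂ) * curv V (y.shift μ) ρ ν *
            star ((V ⟨y, μ⟩ : Matrix.specialUnitaryGroup (Fin 2) ℂ) : Matrix (Fin 2) (Fin 2) ℂ))
            0 (List.replicate ((P.L - 1) / 2) (μ, false)) ++
        stepExps P (curv V y) (Function.update (0 : Fin P.d → ℤ) μ (((P.L - 1) / 2 : ℕ) : ℤ)) (List.replicate ((P.L - 1) / 2) (μ, false))))))) with hl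
  -- box conditions (real form)
  have bA : ∀ (k : ℕ) (ν : Fin P.d), |(((0 : Fin P.d → ℤ) ν + netDisp ((stairWord σ (off r)).take k) ν : ℤ) : ℝ)| ≤ hh :=
    fun k ν => abs_cast_le (box_stairWord σ r k ν)
  have bB₁ : ∀ (k : ℕ) (ν : Fin P.d), |((off r ν + netDisp ((List.replicate ((hh : ℤ) - off r μ).toNat ((μ, true) : Letter P.d)).take k) ν : ℤ) : ℝ)| ≤ hh :=
    fun k ν => abs_cast_le (box_replicate_true hnb μ (by have := hnb μ; omega) k ν)
  have hgb : ∀ ν, -(hh : ℤ) ≤ Function.update (off r) μ (-(hh : ℤ)) ν ∧ Function.update (off r) μ (-(hh : ℤ)) ν ≤ hh := fun ν => by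
    rw [Function.update_apply]; split_ifs <;> [omega; exact hnb ν]
  have bB₂ : ∀ (k : ℕ) (ν : Fin P.d), |((Function.update (off r) μ (-(hh : ℤ)) ν +
      netDisp ((List.replicate (off r μ + (hh : ℤ)).toNat ((μ, true) : Letter P.d)).take k) ν : ℤ) : ℝ)| ≤ hh :=
    fun k ν => abs_cast_le (box_replicate_true hgb μ (by rw [Function.update_self]; have := hnb μ; omega) k ν)
  have bC : ∀ (k : ℕ) (ν : Fin P.d), |((off r ν + netDisp ((wordRev (stairWord σ' (off r))).take k) ν : ℤ) : ℝ)| ≤ hh :=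
    fun k ν => abs_cast_le (box_wordRev_stairWord σ' r k ν)
  have h0b : ∀ ν, -(hh : ℤ) ≤ (0 : Fin P.d → ℤ) ν ∧ (0 : Fin P.d → ℤ) ν ≤ hh := fun ν => by simp only [Pi.zero_apply]; omega
  have bD₁ : ∀ (k : ℕ) (ν : Fin P.d), |(((0 : Fin P.d → ℤ) ν + netDisp ((List.replicate hh ((μ, false) : Letter P.d)).take k) ν : ℤ) : ℝ)| ≤ hh :=
    fun k ν => abs_cast_le (box_replicate_false h0b μ (by simp only [Pi.zero_apply]; omega) k ν)
  have hzb : ∀ ν, -(hh : ℤ) ≤ Function.update (0 : Fin P.d → ℤ) μ (hh : ℤ) ν ∧ Function.update (0 : Fin P.d → ℤ) μ (hh : ℤ) ν ≤ hh :=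
    fun ν => by rw [Function.update_apply]; split_ifs <;> [omega; (rw [Pi.zero_apply]; omega)]
  have bD₂ : ∀ (k : ℕ) (ν : Fin P.d), |((Function.update (0 : Fin P.d → ℤ) μ (hh : ℤ) ν +
      netDisp ((List.replicate hh ((μ, false) : Letter P.d)).take k) ν : ℤ) : ℝ)| ≤ hh :=
    fun k ν => abs_cast_le (box_replicate_false hzb μ (by rw [Function.update_self]; omega) k ν)
  have hfb : ∀ ν, -(hh : ℤ) ≤ Function.update (off r) μ (hh : ℤ) ν ∧ Function.update (off r) μ (hh : ℤ) ν ≤ hh := fun ν => by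
    rw [Function.update_apply]; split_ifs <;> [omega; exact hnb ν]
  -- the uniform element bound `d·a`
  have hel0 : (P.d : ℝ) * hh * (2 * a) / (2 * (P.L : ℝ) ^ 2) ≤ (P.d : ℝ) * a := by
    rw [div_le_iff₀ (by positivity)]
    have h1 : (hh : ℝ) ≤ (P.L : ℝ) ^ 2 := by nlinarith
    nlinarith [mul_le_mul_of_nonneg_left h1 (by positivity : (0:ℝ) ≤ 2 * (P.d : ℝ) * a)]
  have hface : ‖((P.L : ℝ) + 1) • potAt P F (Function.update (off r) μ (hh : ℤ)) μ‖ ≤ (P.d : ℝ) * a := by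
    rw [norm_smul, Real.norm_of_nonneg (by linarith)]
    have hp := norm_potAt_le P F hh0 hFn (fun ν => abs_cast_le (hfb ν)) μ
    have h1 : ((P.L : ℝ) + 1) * (hh : ℝ) ≤ (P.L : ℝ) ^ 2 := by rw [hLr]; nlinarith
    calc ((P.L : ℝ) + 1) * ‖potAt P F (Function.update (off r) μ (hh : ℤ)) μ‖ ≤ ((P.L : ℝ) + 1) * ((P.d : ℝ) * hh * (2 * a) / (2 * (P.L : ℝ) ^ 2)) := by
          gcongr
      _ = (P.d : ℝ) * a * (((P.L : ℝ) + 1) * (hh : ℝ) / (P.L : ℝ) ^ 2) := by field_simp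
      _ ≤ (P.d : ℝ) * a * 1 := by gcongr; rw [div_le_one (by positivity)]; exact h1
      _ = (P.d : ℝ) * a := mul_one _
  have hel : ∀ X ∈ l, ‖X‖ ≤ (P.d : ℝ) * a := by
    intro X hX
    rw [hl] at hX
    simp only [List.mem_append, List.mem_cons, List.mem_nil_iff, or_false] at hX
    rcases hX with h | h | h | h | h | h | h
    · exact (norm_mem_stepExps_le P F hh0 hFn _ _ bA X h).trans hel0
    · exact (norm_mem_stepExps_le P F hh0 hFn _ _ bB₁ X h).trans hel0
    · rw [h]; exact hface
    · exact (norm_mem_stepExps_le P F'' hh0 hF''n _ _ bB₂ X h).trans hel0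
    · exact (norm_mem_stepExps_le P F'' hh0 hF''n _ _ bC X h).trans hel0
    · exact (norm_mem_stepExps_le P F'' hh0 hF''n _ _ bD₁ X h).trans hel0
    · exact (norm_mem_stepExps_le P F hh0 hFn _ _ bD₂ X h).trans hel0
  -- the length of the list and the total exponent norm `≤ T`
  have hlen : (l.length : ℝ) ≤ ((P.d : ℝ) + 2) * (P.L : ℝ) := by
    have h1 := LatticeWordStokes.length_stairWord_le σ (off r) hh (fun ν => by have := off_bounds r ν; omega)
    have h2 := LatticeWordStokes.length_stairWord_le σ' (off r) hh (fun ν => by have := off_bounds r ν; omega)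
    have ht : ((hh : ℤ) - off r μ).toNat + (off r μ + (hh : ℤ)).toNat = 2 * hh := by have := hnb μ; omega
    have hexp : (P.d + 2) * P.L = 2 * (P.d * hh) + P.d + 4 * hh + 2 := by rw [hLn]; ring
    have hnat : l.length ≤ (P.d + 2) * P.L := by
      rw [hl]
      simp only [List.length_append, List.length_cons, List.length_nil, length_stepExps, List.length_replicate, wordRev,
        List.length_reverse, List.length_map]
      rw [hexp, ← hhh]
      linarith
    exact_mod_cast hnat
  have hTl0 : 0 ≤ (l.map (‖·‖)).sum :=
    List.sum_nonneg (by intro t ht; obtain ⟨z, -, rfl⟩ := List.mem_map.1 ht; exact norm_nonneg _)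
  have hTl : (l.map (‖·‖)).sum ≤ T := by
    have h1 : (l.map (‖·‖)).sum ≤ (l.map (‖·‖)).length • ((P.d : ℝ) * a) :=
      List.sum_le_card_nsmul _ _ fun x hx => by obtain ⟨X, hX, rfl⟩ := List.mem_map.1 hx; exact hel X hX
    rw [List.length_map, nsmul_eq_mul] at h1
    calc _ ≤ (l.length : ℝ) * ((P.d : ℝ) * a) := h1
      _ ≤ (((P.d : ℝ) + 2) * (P.L : ℝ)) * ((P.d : ℝ) * a) := by gcongr
      _ = T := by rw [hTdef]; ring
  have hTl1 : (l.map (‖·‖)).sum ≤ 1 := hTl.trans (by linarith)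
  -- the product versus the exponential of the sum, and versus `1`
  have hPexp : ‖(l.map exp).prod - exp l.sum‖ ≤ 2 * T ^ 2 :=
    (norm_prod_exp_sub_exp_sum_le l hTl1).trans (by gcongr)
  have hP1 : ‖(l.map exp).prod - 1‖ ≤ 2 * T :=
    (norm_prod_exp_sub_one_le l).trans ((exp_sub_one_le_two_mul hTl0 (hTl.trans (by linarith))).trans (by linarith))
  refine ⟨?_, E, hEn, ?_⟩
  · -- `|loop − 1| ≤ 2T`
    have hd : dist1 (loopHol (interp V) ⟨y, μ⟩ (r, σ, σ')) =
        ‖((loopHol (interp V) ⟨y, μ⟩ (r, σ, σ') : Matrix.specialUnitaryGroup (Fin 2) ℂ) : Matrix (Fin 2) (Fin 2) ℂ) - 1‖ := rfl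
    rw [hd, hprod]; exact hP1
  · -- `‖log loop − Σ‖ ≤ 3T²`
    rw [hprod, ← hsum]
    have hsn : ‖l.sum‖ ≤ T := (Summit.QuantumFields.BalabanUV.Beta.EriceAxialGaugeWords.norm_list_sum_le l).trans hTl
    have hlog2 := Real.log_two_gt_d9
    have hmlog : mlog (exp l.sum) = l.sum := B7BlockAvgLog.mlog_exp (by linarith)
    have hA : ‖(l.map exp).prod - 1‖ ≤ 1 / 3 := hP1.trans (by linarith)
    have hB : ‖exp l.sum - 1‖ ≤ 1 / 3 :=
      (Literature.Analysis.Calculus.norm_exp_sub_one_le _).trans ((exp_sub_one_le_two_mul (norm_nonneg _) (hsn.trans (by linarith))).trans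
        (by linarith))
    have hlip := FederbushMean.norm_mlog_sub_mlog_le (ρ := 1 / 3) (by norm_num) hA hB
    conv_lhs => rw [← hmlog]
    calc ‖mlog (l.map exp).prod - mlog (exp l.sum)‖ ≤ (1 + 1 / 3 / (1 - 1 / 3)) * ‖(l.map exp).prod - exp l.sum‖ := hlip
      _ ≤ (1 + 1 / 3 / (1 - 1 / 3)) * (2 * T ^ 2) := by gcongr
      _ = 3 * T ^ 2 := by ring

end OneLoop

/-! ## §2 The consistency of the interpolation -/

section Consistency

/-- **CONSISTENCY OF THE SMOOTH INTERPOLATION WITH ITS BLOCK AVERAGE.**  Let `V` be a coarse `SU(2)` field on `T^{(j+1)}` (standing range)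
with `|V(∂p) − 1| ≤ a` for all ordered coarse plaquettes and covariant-constancy defect `‖V(y,κ)F(y+e_κ)V(y,κ)* − F(y)‖ ≤ b′`, and put
`T = (d+2)L·d·a`.  If `T ≤ 1/8` and `3T² + d²b′ ≤ 1/2`, then for every coarse bond `c`:
`‖V(c) − avg(interp V)(c)‖ ≤ 2(3T² + d²b′)` — Bałaban's (0.4) average (printed exp-mean-log operation on `SU(2)`) of the interpolation
reproduces `V` to second order in the field and first order in its curvature gradient. [cite: Balaban1987RG1, (0.4) p.253] -/
theorem norm_sub_avgFun_interp_le (hj : j + 1 ≤ P.m + P.K) (V : GaugeField P (j+1) (Matrix.specialUnitaryGroup (Fin 2) ℂ)) {a b' : ℝ}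
    (hV : ∀ (y : Site P (j+1)) (κ μ : Fin P.d),
      ‖((plaqElt V y κ μ : Matrix.specialUnitaryGroup (Fin 2) ℂ) : Matrix (Fin 2) (Fin 2) ℂ) - 1‖ ≤ a)
    (hcc : ∀ (y : Site P (j+1)) (κ ρ μ : Fin P.d),
      ‖((V ⟨y, κ⟩ : Matrix.specialUnitaryGroup (Fin 2) ℂ) : Matrix (Fin 2) (Fin 2) ℂ) * curv V (y.shift κ) ρ μ *
          star ((V ⟨y, κ⟩ : Matrix.specialUnitaryGroup (Fin 2) ℂ) : Matrix (Fin 2) (Fin 2) ℂ) - curv V y ρ μ‖ ≤ b')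
    (hT : ((P.d : ℝ) + 2) * (P.L : ℝ) * (P.d : ℝ) * a ≤ 1 / 8)
    (hρ : 3 * (((P.d : ℝ) + 2) * (P.L : ℝ) * (P.d : ℝ) * a) ^ 2 + (P.d : ℝ) ^ 2 * b' ≤ 1 / 2) (c : PBond P (j+1)) :
    ‖((V c : Matrix.specialUnitaryGroup (Fin 2) ℂ) : Matrix (Fin 2) (Fin 2) ℂ) -
        ((avgFun (expMeanLogSU (n := Fin 2)) (interp V) c : Matrix.specialUnitaryGroup (Fin 2) ℂ) : Matrix (Fin 2) (Fin 2) ℂ)‖ ≤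
      2 * (3 * (((P.d : ℝ) + 2) * (P.L : ℝ) * (P.d : ℝ) * a) ^ 2 + (P.d : ℝ) ^ 2 * b') := by
  letI : NormedAlgebra ℚ (Matrix (Fin 2) (Fin 2) ℂ) := NormedAlgebra.restrictScalars ℚ ℂ _
  obtain ⟨y, μ⟩ := c
  set T : ℝ := ((P.d : ℝ) + 2) * (P.L : ℝ) * (P.d : ℝ) * a with hTdef
  set ρ₀ : ℝ := 3 * T ^ 2 + (P.d : ℝ) ^ 2 * b' with hρ₀
  have hb0 : 0 ≤ b' := (norm_nonneg _).trans (hcc y μ μ μ)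
  have hρ0 : 0 ≤ ρ₀ := by positivity
  -- the radius of the printed operation on `SU(2)` is `1/3`
  have hδ : (expMeanLogSU (n := Fin 2)).δ = 1 / 3 := by
    rw [expMeanLogSU_δ, Fintype.card_fin, min_eq_left]; have := Real.pi_gt_three; push_cast; linarith
  -- per loop
  have hguard : Small (expMeanLogSU (n := Fin 2)) (interp V) ⟨y, μ⟩ := fun i => by
    obtain ⟨r, σ, σ'⟩ := i
    rw [hδ]
    exact (loop_estimates hj V hV hcc hT y μ r σ σ').1.trans_lt (by linarith)
  choose E hE hlog using fun i : Idx P => (loop_estimates hj V hV hcc hT y μ i.1 i.2.1 i.2.2).2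
  -- the sum of the logarithms
  have hsum : ‖∑ i : Idx P, mlog ((loopHol (interp V) ⟨y, μ⟩ i : Matrix.specialUnitaryGroup (Fin 2) ℂ) : Matrix (Fin 2) (Fin 2) ℂ)‖ ≤
      (Fintype.card (Idx P) : ℝ) * ρ₀ := by
    have hdec : ∑ i : Idx P, mlog ((loopHol (interp V) ⟨y, μ⟩ i : Matrix.specialUnitaryGroup (Fin 2) ℂ) : Matrix (Fin 2) (Fin 2) ℂ) =
        ∑ i : Idx P, (mlog ((loopHol (interp V) ⟨y, μ⟩ i : Matrix.specialUnitaryGroup (Fin 2) ℂ) : Matrix (Fin 2) (Fin 2) ℂ) -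
          ((stepExps P (curv V y) 0 (stairWord i.2.1 (off i.1))).sum - (stepExps P (curv V y) 0 (stairWord i.2.2 (off i.1))).sum +
            (2 * (P.L : ℝ)) • potAt P (curv V y) (off i.1) μ + E i)) +
        ∑ i : Idx P, ((stepExps P (curv V y) 0 (stairWord i.2.1 (off i.1))).sum - (stepExps P (curv V y) 0 (stairWord i.2.2 (off i.1))).sum +
            (2 * (P.L : ℝ)) • potAt P (curv V y) (off i.1) μ) + ∑ i : Idx P, E i := by
      rw [← Finset.sum_add_distrib, ← Finset.sum_add_distrib]
      exact Finset.sum_congr rfl fun i _ => by abel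
    rw [hdec, sum_main_eq_zero P (curv V y) μ, add_zero]
    refine (norm_add_le _ _).trans ?_
    have h1 : ‖∑ i : Idx P, (mlog ((loopHol (interp V) ⟨y, μ⟩ i : Matrix.specialUnitaryGroup (Fin 2) ℂ) : Matrix (Fin 2) (Fin 2) ℂ) -
        ((stepExps P (curv V y) 0 (stairWord i.2.1 (off i.1))).sum - (stepExps P (curv V y) 0 (stairWord i.2.2 (off i.1))).sum +
          (2 * (P.L : ℝ)) • potAt P (curv V y) (off i.1) μ + E i))‖ ≤ (Fintype.card (Idx P) : ℝ) * (3 * T ^ 2) := by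
      refine (norm_sum_le _ _).trans ?_
      calc _ ≤ ∑ _i : Idx P, 3 * T ^ 2 := Finset.sum_le_sum fun i _ => hlog i
        _ = _ := by rw [Finset.sum_const, Finset.card_univ, nsmul_eq_mul]
    have h2 : ‖∑ i : Idx P, E i‖ ≤ (Fintype.card (Idx P) : ℝ) * ((P.d : ℝ) ^ 2 * b') := by
      refine (norm_sum_le _ _).trans ?_
      calc _ ≤ ∑ _i : Idx P, (P.d : ℝ) ^ 2 * b' := Finset.sum_le_sum fun i _ => hE i
        _ = _ := by rw [Finset.sum_const, Finset.card_univ, nsmul_eq_mul]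
    calc _ ≤ (Fintype.card (Idx P) : ℝ) * (3 * T ^ 2) + (Fintype.card (Idx P) : ℝ) * ((P.d : ℝ) ^ 2 * b') := add_le_add h1 h2
      _ = (Fintype.card (Idx P) : ℝ) * ρ₀ := by rw [hρ₀]; ring
  -- the correction factor
  set M : Matrix (Fin 2) (Fin 2) ℂ := ((Fintype.card (Idx P) : ℂ))⁻¹ •
    ∑ i : Idx P, mlog ((loopHol (interp V) ⟨y, μ⟩ i : Matrix.specialUnitaryGroup (Fin 2) ℂ) : Matrix (Fin 2) (Fin 2) ℂ) with hM
  have hN : (0 : ℝ) < Fintype.card (Idx P) := by exact_mod_cast Fintype.card_pos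
  have hMn : ‖M‖ ≤ ρ₀ := by
    rw [hM, norm_smul, norm_inv, Complex.norm_natCast]
    calc (Fintype.card (Idx P) : ℝ)⁻¹ * ‖∑ i : Idx P, mlog ((loopHol (interp V) ⟨y, μ⟩ i : Matrix.specialUnitaryGroup (Fin 2) ℂ) : Matrix (Fin 2) (Fin 2) ℂ)‖
        ≤ (Fintype.card (Idx P) : ℝ)⁻¹ * ((Fintype.card (Idx P) : ℝ) * ρ₀) := by gcongr
      _ = ρ₀ := by field_simp
  have hcorr : ((corr (expMeanLogSU (n := Fin 2)) (interp V) ⟨y, μ⟩ : Matrix.specialUnitaryGroup (Fin 2) ℂ) : Matrix (Fin 2) (Fin 2) ℂ) = exp M := by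
    unfold BlockAveraging.corr
    rw [if_pos hguard]
    exact coe_avg_expMeanLogSU _ hguard
  -- assemble
  have havg : avgFun (expMeanLogSU (n := Fin 2)) (interp V) ⟨y, μ⟩ = corr (expMeanLogSU (n := Fin 2)) (interp V) ⟨y, μ⟩ * axialAvg (interp V) ⟨y, μ⟩ := rfl
  rw [havg, Submonoid.coe_mul, hcorr, axialAvg_interp hj V]
  set v : Matrix (Fin 2) (Fin 2) ℂ := ((V ⟨y, μ⟩ : Matrix.specialUnitaryGroup (Fin 2) ℂ) : Matrix (Fin 2) (Fin 2) ℂ) with hv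
  have hsplit : v - exp M * v = (1 - exp M) * v := by noncomm_ring
  rw [hsplit]
  calc ‖(1 - exp M) * v‖ ≤ ‖1 - exp M‖ * ‖v‖ := norm_mul_le _ _
    _ ≤ ‖1 - exp M‖ * 1 := by gcongr; exact SmoothLiftFibre.norm_coe_su2_le _
    _ = ‖exp M - 1‖ := by rw [mul_one, ← norm_neg, neg_sub]
    _ ≤ Real.exp ‖M‖ - 1 := Literature.Analysis.Calculus.norm_exp_sub_one_le M
    _ ≤ 2 * ‖M‖ := exp_sub_one_le_two_mul (norm_nonneg _) (hMn.trans hρ)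
    _ ≤ 2 * ρ₀ := by gcongr

end Consistency


end Summit.QuantumFields.YangMills.Theorems.SmoothLiftInterp

end
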